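import Mathlib
import Literature.Analysis.PDE.Wave1DFarConeDuhamelData
import Literature.Analysis.PDE.Wave1DFarEnergyLimits
import Literature.Analysis.Calculus.TwoVariablePartials
import HarnessLib

/-!
# Far-side channel estimate: the Duhamel comparison step

Analysis/PDE support file (everything proved, no definitions). Let `V ≥ 0` be continuous with
`|V − n(n+1)ι²| ≤ A x^{−5/2}` and `n(n+1)ι² ≤ 2V` on `[ρ,∞)` (`ρ ≥ 1`, `n ≥ 1`, `ι = 1/x` there).
Let `φ` be a global `C²` function whose `V`-residual vanishes on `{x > ½}` and `ψ₀` a global `C²`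
solution of the exact equation `ψ_tt = ψ_xx − n(n+1)ι²ψ` on `{x > ½}` whose exact energy on
`(ρ,∞)` at `t = 0` is `≤ E₀`, and suppose the `V`-energy of the data of `w = φ − ψ₀` on `(ρ,∞)`
is `≤ θ`. The source of `w` on `{x ≥ ρ}` is `−(V − n(n+1)ι²)ψ₀`, of sliced `L²` norm
`≤ |A| (E₀/2)^{1/2} (ρ+|τ|)^{−3/2}` by the decay of the exact far energy of `ψ₀`; the far-cone
Duhamel bound with data (`Wave1DFarConeDuhamelData`) gives `E_V[w](t; x > ρ+|t|) ≤ 2θ + 16A²E₀/ρ`,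
whence (`farComparison_duhamel`) for every `t`

  `∫⁻_{x>ρ+|t|} e₀[ψ₀](t) ≤ 4 ∫⁻_{x>ρ+|t|} e_V[φ](t) + 4·(2θ + 16 A² E₀/ρ)`

(`e₀` the exact, `e_V` the `V`-energy density). Taking `t → ±∞` bounds the exact channel energies
of the cut-off data by the true channel energies of `φ` plus terms that are small for large `ρ`
and small tails. Route PhotonSphereChannels, `FixedModeChannels`, far side
(stmt-FinalStateConjecture-10048). Folklore (Duhamel).
-/

noncomputable section

namespace Literature.Analysis.PDE

open MeasureTheory Set Filter Topology Literature.Analysis.Calculus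

/-- `∫_0^t (ρ+τ)^{−3/2} dτ ≤ 2ρ^{−1/2}` for `t ≥ 0`, `ρ > 0`. [folklore] -/
theorem integral_add_rpow_neg_three_halves_le {ρ t : ℝ} (hρ : 0 < ρ) (ht : 0 ≤ t) :
    ∫ τ in (0 : ℝ)..t, (ρ + τ) ^ (-(3 / 2 : ℝ)) ≤ 2 * ρ ^ (-(1 / 2 : ℝ)) := by
  rw [intervalIntegral.integral_comp_add_left (fun x : ℝ => x ^ (-(3 / 2 : ℝ))) ρ, add_zero,
    integral_rpow (Or.inr ⟨by norm_num, ?_⟩)]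
  · have h1 : 0 ≤ (ρ + t) ^ (-(3 / 2 : ℝ) + 1) := Real.rpow_nonneg (by linarith) _
    have h3 : (-(3 / 2 : ℝ) + 1) = -(1 / 2) := by norm_num
    rw [h3] at h1 ⊢
    have : ((ρ + t) ^ (-(1 / 2 : ℝ)) - ρ ^ (-(1 / 2 : ℝ))) / (-(1 / 2 : ℝ))
        = 2 * (ρ ^ (-(1 / 2 : ℝ)) - (ρ + t) ^ (-(1 / 2 : ℝ))) := by ring
    rw [this]; linarith
  · rw [uIcc_of_le (by linarith)]
    intro h
    have : (0 : ℝ) < 0 := by linarith [h.1]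
    exact absurd this (lt_irrefl _)

/-- The residual `φ_tt − φ_xx + Wφ` of a `C²` function is continuous (local copy of
`FarKernelSpanLemmas.continuous_wave1D_residual`, kept private to decouple build order). [folklore] -/
private theorem continuous_wave1D_residual_loc' {W : ℝ → ℝ} (hW : Continuous W) {φ : ℝ → ℝ → ℝ}
    (hφ : ContDiff ℝ 2 (Function.uncurry φ)) :
    Continuous (Function.uncurry fun t x =>
      iteratedDeriv 2 (fun τ => φ τ x) t - iteratedDeriv 2 (φ t) x + W x * φ t x) := by
  obtain ⟨-, -, φtt, -, φxx, -, -, hctt, -, hcxx, -, -, -, -, -, -, h7, h8⟩ :=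
    exists_partials_of_contDiff_two hφ
  have : (Function.uncurry fun t x =>
      iteratedDeriv 2 (fun τ => φ τ x) t - iteratedDeriv 2 (φ t) x + W x * φ t x)
      = fun p : ℝ × ℝ => φtt p.1 p.2 - φxx p.1 p.2 + W p.2 * φ p.1 p.2 := by
    funext p; simp only [Function.uncurry, h7, h8]
  rw [this]
  exact (hctt.sub hcxx).add ((hW.comp continuous_snd).mul hφ.continuous)

variable {V ι : ℝ → ℝ} {φ ψ₀ : ℝ → ℝ → ℝ}

set_option maxHeartbeats 400000 in
/-- **Duhamel comparison step of the far-side channel estimate.** See the module docstring.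
[folklore] -/
theorem farComparison_duhamel (hV : Continuous V) (hV0 : ∀ x, 0 ≤ V x)
    (hι : ContDiff ℝ (⊤ : ℕ∞) ι) (hιeq : ∀ x : ℝ, 1 / 2 ≤ x → ι x = x⁻¹) {n : ℕ} (hn : 1 ≤ n)
    {A ρ : ℝ} (hρ1 : 1 ≤ ρ)
    (hVA : ∀ x, ρ ≤ x → |V x - n * (n + 1) * ι x ^ 2| ≤ A * x ^ (-(5 / 2 : ℝ)))
    (hV2 : ∀ x, ρ ≤ x → (n : ℝ) * (n + 1) * ι x ^ 2 ≤ 2 * V x)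
    (hφ : ContDiff ℝ 2 (Function.uncurry φ))
    (hφres : ∀ t x, 1 / 2 < x →
      iteratedDeriv 2 (fun τ => φ τ x) t - iteratedDeriv 2 (φ t) x + V x * φ t x = 0)
    (hψ₀ : ContDiff ℝ 2 (Function.uncurry ψ₀))
    (hψ₀res : ∀ t, ∀ x ∈ Ioi (1 / 2 : ℝ), iteratedDeriv 2 (fun τ => ψ₀ τ x) t
      = iteratedDeriv 2 (ψ₀ t) x - n * (n + 1) * ι x ^ 2 * ψ₀ t x)
    {θ E₀ : ℝ}
    (hθ : IntegrableOn (fun x => deriv (fun τ => φ τ x - ψ₀ τ x) 0 ^ 2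
        + deriv (fun y => φ 0 y - ψ₀ 0 y) x ^ 2 + V x * (φ 0 x - ψ₀ 0 x) ^ 2) (Ioi ρ) ∧
      ∫ x in Ioi ρ, (deriv (fun τ => φ τ x - ψ₀ τ x) 0 ^ 2
        + deriv (fun y => φ 0 y - ψ₀ 0 y) x ^ 2 + V x * (φ 0 x - ψ₀ 0 x) ^ 2) ≤ θ)
    (hE₀ : IntegrableOn (fun x => deriv (fun τ => ψ₀ τ x) 0 ^ 2 + deriv (ψ₀ 0) x ^ 2
        + n * (n + 1) * ι x ^ 2 * ψ₀ 0 x ^ 2) (Ioi ρ) ∧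
      ∫ x in Ioi ρ, (deriv (fun τ => ψ₀ τ x) 0 ^ 2 + deriv (ψ₀ 0) x ^ 2
        + n * (n + 1) * ι x ^ 2 * ψ₀ 0 x ^ 2) ≤ E₀) (t : ℝ) :
    ∫⁻ x in Ioi (ρ + |t|), ENNReal.ofReal (deriv (fun τ => ψ₀ τ x) t ^ 2 + deriv (ψ₀ t) x ^ 2
        + n * (n + 1) * ι x ^ 2 * ψ₀ t x ^ 2)
      ≤ 4 * (∫⁻ x in Ioi (ρ + |t|), ENNReal.ofReal (deriv (fun τ => φ τ x) t ^ 2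
          + deriv (φ t) x ^ 2 + V x * φ t x ^ 2))
        + 4 * ENNReal.ofReal (2 * θ + 16 * A ^ 2 * E₀ / ρ) := by
  have hρ0 : 0 < ρ := by linarith
  have hn2 : (2 : ℝ) ≤ n * (n + 1) := by
    have : (1 : ℝ) ≤ n := by exact_mod_cast hn
    nlinarith
  -- the exact potential
  set V₀ : ℝ → ℝ := fun x => (n : ℝ) * (n + 1) * ι x ^ 2 with hV₀
  have hV₀c : Continuous V₀ := continuous_const.mul (hι.continuous.pow 2)
  have hV₀0 : ∀ x, 0 ≤ V₀ x := fun x => by simp only [hV₀]; positivity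
  -- slices
  have hsl : ∀ (χ : ℝ → ℝ → ℝ), ContDiff ℝ 2 (Function.uncurry χ) → ∀ t x,
      ContDiff ℝ 2 (fun τ => χ τ x) ∧ ContDiff ℝ 2 (χ t) := fun χ hχ t x =>
    ⟨hχ.comp (contDiff_id.prodMk contDiff_const), hχ.comp (contDiff_const.prodMk contDiff_id)⟩
  -- the residual of `ψ₀` with respect to `V₀` vanishes on `x > 1/2`
  set G : ℝ → ℝ → ℝ := fun t x =>
    iteratedDeriv 2 (fun τ => ψ₀ τ x) t - iteratedDeriv 2 (ψ₀ t) x + V₀ x * ψ₀ t x with hG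
  have hGc : Continuous (Function.uncurry G) := continuous_wave1D_residual_loc' hV₀c hψ₀
  have hGsol : ∀ t x, iteratedDeriv 2 (fun τ => ψ₀ τ x) t - iteratedDeriv 2 (ψ₀ t) x
      + V₀ x * ψ₀ t x = G t x := fun t x => rfl
  have hGfar : ∀ t x, 1 / 2 < x → G t x = 0 := by
    intro t x hx
    simp only [hG, hV₀, hψ₀res t x hx]; ring
  have hG0 : ∀ τ x, ρ ≤ x → G τ x = 0 := fun τ x hx => hGfar τ x (by linarith)
  -- the difference and its residual
  set w : ℝ → ℝ → ℝ := fun t x => φ t x - ψ₀ t x with hw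
  have hwC : ContDiff ℝ 2 (Function.uncurry w) := hφ.sub hψ₀
  set F : ℝ → ℝ → ℝ := fun t x =>
    iteratedDeriv 2 (fun τ => w τ x) t - iteratedDeriv 2 (w t) x + V x * w t x with hF
  have hFc : Continuous (Function.uncurry F) := continuous_wave1D_residual_loc' hV hwC
  have hwsol : ∀ t x, iteratedDeriv 2 (fun τ => w τ x) t - iteratedDeriv 2 (w t) x + V x * w t x
      = F t x := fun t x => rfl
  have hFfar : ∀ t x, 1 / 2 < x → F t x = -((V x - V₀ x) * ψ₀ t x) := by
    intro t x hx
    show iteratedDeriv 2 (fun τ => φ τ x - ψ₀ τ x) t - iteratedDeriv 2 (fun y => φ t y - ψ₀ t y) x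
        + V x * (φ t x - ψ₀ t x) = -((V x - V₀ x) * ψ₀ t x)
    rw [iteratedDeriv_fun_sub (n := 2) (hsl φ hφ t x).1.contDiffAt (hsl ψ₀ hψ₀ t x).1.contDiffAt,
      iteratedDeriv_fun_sub (n := 2) (hsl φ hφ t x).2.contDiffAt (hsl ψ₀ hψ₀ t x).2.contDiffAt,
      hψ₀res t x hx]
    have e1 := hφres t x hx
    simp only [hV₀]
    linarith
  -- finiteness and decay of the exact far energy of `ψ₀`
  have hE₀0 : 0 ≤ E₀ := le_trans (setIntegral_nonneg measurableSet_Ioi fun x _ =>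
    wave1D_energyDensity_nonneg hV₀0 0 x) hE₀.2
  have hfin0 : ∫⁻ x in Ioi ρ, ENNReal.ofReal (deriv (fun τ => ψ₀ τ x) 0 ^ 2 + deriv (ψ₀ 0) x ^ 2
      + V₀ x * ψ₀ 0 x ^ 2) < ⊤ := by
    rw [← ofReal_integral_eq_lintegral_ofReal hE₀.1
      (ae_of_all _ fun x => wave1D_energyDensity_nonneg hV₀0 0 x)]
    exact ENNReal.ofReal_lt_top
  have hψ₀far : ∀ τ, IntegrableOn (fun x => deriv (fun σ => ψ₀ σ x) τ ^ 2 + deriv (ψ₀ τ) x ^ 2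
        + V₀ x * ψ₀ τ x ^ 2) (Ioi (ρ + |τ|)) ∧
      ∫ x in Ioi (ρ + |τ|), (deriv (fun σ => ψ₀ σ x) τ ^ 2 + deriv (ψ₀ τ) x ^ 2 + V₀ x * ψ₀ τ x ^ 2)
        ≤ E₀ := by
    intro τ
    have h1 := (wave1D_farEnergy_integrableOn hV₀c hV₀0 hGc hψ₀ hGsol (c := ρ) hG0 hfin0 τ).1
    refine ⟨h1, le_trans ?_ hE₀.2⟩
    rcases le_total 0 τ with hτ | hτ
    · have h2 := wave1D_farEnergy_real_mono_nonneg hV₀c hV₀0 hGc hψ₀ hGsol (c := ρ) hG0 hfin0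
        le_rfl hτ
      simpa only [abs_zero, add_zero] using h2
    · have h2 := wave1D_farEnergy_real_mono_nonpos hV₀c hV₀0 hGc hψ₀ hGsol (c := ρ) hG0 hfin0
        le_rfl hτ
      simpa only [abs_zero, add_zero] using h2
  -- the source bound on slices: `∫_{ρ+|τ|}^{b} F² ≤ (A²/2)(ρ+|τ|)^{-3} E₀`
  have hslice : ∀ τ b, ∫ x in (ρ + |τ|)..b, F τ x ^ 2
      ≤ A ^ 2 / 2 * (ρ + |τ|) ^ (-(3 : ℝ)) * E₀ := by
    intro τ b
    have hτ0 : 0 < ρ + |τ| := by positivity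
    rcases le_or_gt b (ρ + |τ|) with hb | hb
    · rw [intervalIntegral.integral_of_ge hb]
      have : 0 ≤ ∫ x in Ioc b (ρ + |τ|), F τ x ^ 2 :=
        setIntegral_nonneg measurableSet_Ioc fun x _ => sq_nonneg _
      have : 0 ≤ A ^ 2 / 2 * (ρ + |τ|) ^ (-(3 : ℝ)) * E₀ := by positivity
      linarith
    · obtain ⟨hint, hle⟩ := hψ₀far τ
      have hpt : ∀ x ∈ Ioc (ρ + |τ|) b, F τ x ^ 2
          ≤ A ^ 2 / 2 * (ρ + |τ|) ^ (-(3 : ℝ)) * (deriv (fun σ => ψ₀ σ x) τ ^ 2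
            + deriv (ψ₀ τ) x ^ 2 + V₀ x * ψ₀ τ x ^ 2) := by
        intro x hx
        have hxρ : ρ ≤ x := by linarith [hx.1, abs_nonneg τ]
        have hx0 : 0 < x := by linarith
        rw [hFfar τ x (by linarith), neg_sq, mul_pow]
        -- `(V − V₀)² ≤ A² x^{-5}`
        have hd : (V x - V₀ x) ^ 2 ≤ A ^ 2 * x ^ (-(5 : ℝ)) := by
          have h := hVA x hxρ
          have h' : |V x - V₀ x| ^ 2 ≤ (A * x ^ (-(5 / 2 : ℝ))) ^ 2 :=
            pow_le_pow_left₀ (abs_nonneg _) h 2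
          rw [sq_abs, mul_pow, ← Real.rpow_natCast (x ^ (-(5 / 2 : ℝ))) 2,
            ← Real.rpow_mul hx0.le, show (-(5 / 2 : ℝ)) * ((2 : ℕ) : ℝ) = -(5 : ℝ) by norm_num] at h'
          exact h'
        -- `x^{-5} ψ₀² ≤ (ρ+|τ|)^{-3} · (1/2) V₀ ψ₀²`
        have hx3 : x ^ (-(3 : ℝ)) ≤ (ρ + |τ|) ^ (-(3 : ℝ)) :=
          Real.rpow_le_rpow_of_nonpos hτ0 hx.1.le (by norm_num)
        have hιx : ι x = x⁻¹ := hιeq x (by linarith)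
        have hx2V : x ^ (-(2 : ℝ)) * ψ₀ τ x ^ 2 ≤ (1 / 2) * (V₀ x * ψ₀ τ x ^ 2) := by
          have : x ^ (-(2 : ℝ)) = ι x ^ 2 := by
            rw [hιx, Real.rpow_neg hx0.le, Real.rpow_two, inv_pow]
          rw [this, hV₀]
          have h0 : 0 ≤ ι x ^ 2 * ψ₀ τ x ^ 2 := by positivity
          nlinarith
        have hsplit : x ^ (-(5 : ℝ)) = x ^ (-(3 : ℝ)) * x ^ (-(2 : ℝ)) := by
          rw [← Real.rpow_add hx0]; norm_num
        have hrest : 0 ≤ deriv (fun σ => ψ₀ σ x) τ ^ 2 + deriv (ψ₀ τ) x ^ 2 := by positivity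
        have hV₀x := hV₀0 x
        calc (V x - V₀ x) ^ 2 * ψ₀ τ x ^ 2 ≤ A ^ 2 * x ^ (-(5 : ℝ)) * ψ₀ τ x ^ 2 :=
              mul_le_mul_of_nonneg_right hd (sq_nonneg _)
          _ = A ^ 2 * x ^ (-(3 : ℝ)) * (x ^ (-(2 : ℝ)) * ψ₀ τ x ^ 2) := by rw [hsplit]; ring
          _ ≤ A ^ 2 * (ρ + |τ|) ^ (-(3 : ℝ)) * ((1 / 2) * (V₀ x * ψ₀ τ x ^ 2)) := by
              apply mul_le_mul (mul_le_mul_of_nonneg_left hx3 (sq_nonneg A)) hx2V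
                (by positivity) (by positivity)
          _ ≤ A ^ 2 / 2 * (ρ + |τ|) ^ (-(3 : ℝ)) * (deriv (fun σ => ψ₀ σ x) τ ^ 2
              + deriv (ψ₀ τ) x ^ 2 + V₀ x * ψ₀ τ x ^ 2) := by
              have hk : 0 ≤ A ^ 2 / 2 * (ρ + |τ|) ^ (-(3 : ℝ)) := by positivity
              nlinarith
      rw [intervalIntegral.integral_of_le hb.le]
      have hsub : Ioc (ρ + |τ|) b ⊆ Ioi (ρ + |τ|) := Ioc_subset_Ioi_self
      calc ∫ x in Ioc (ρ + |τ|) b, F τ x ^ 2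
          ≤ ∫ x in Ioc (ρ + |τ|) b, A ^ 2 / 2 * (ρ + |τ|) ^ (-(3 : ℝ))
              * (deriv (fun σ => ψ₀ σ x) τ ^ 2 + deriv (ψ₀ τ) x ^ 2 + V₀ x * ψ₀ τ x ^ 2) :=
            setIntegral_mono_on ((hFc.comp (continuous_const.prodMk continuous_id)).pow 2
              |>.integrableOn_Icc.mono_set Ioc_subset_Icc_self)
              ((hint.mono_set hsub).const_mul _) measurableSet_Ioc hpt
        _ = A ^ 2 / 2 * (ρ + |τ|) ^ (-(3 : ℝ)) * ∫ x in Ioc (ρ + |τ|) b,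
              (deriv (fun σ => ψ₀ σ x) τ ^ 2 + deriv (ψ₀ τ) x ^ 2 + V₀ x * ψ₀ τ x ^ 2) :=
            MeasureTheory.integral_const_mul _ _
        _ ≤ A ^ 2 / 2 * (ρ + |τ|) ^ (-(3 : ℝ)) * E₀ := by
            refine mul_le_mul_of_nonneg_left ?_ (by positivity)
            exact (setIntegral_mono_set hint
              (ae_of_all _ fun x => wave1D_energyDensity_nonneg hV₀0 τ x)
              (ae_of_all _ hsub)).trans hle
  -- the majorant
  set m : ℝ → ℝ := fun τ => |A| * Real.sqrt (E₀ / 2) * (ρ + |τ|) ^ (-(3 / 2 : ℝ)) with hm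
  have hmc : Continuous m := by
    refine continuous_const.mul (Continuous.rpow_const (continuous_const.add continuous_abs)
      fun τ => Or.inl ?_)
    have := abs_nonneg τ; positivity
  have hm0 : ∀ τ, 0 ≤ m τ := fun τ => by simp only [hm]; positivity
  have hmsq : ∀ τ, A ^ 2 / 2 * (ρ + |τ|) ^ (-(3 : ℝ)) * E₀ = m τ ^ 2 := by
    intro τ
    have hτ0 : 0 < ρ + |τ| := by positivity
    simp only [hm]
    rw [mul_pow, mul_pow, sq_abs, Real.sq_sqrt (by positivity), ← Real.rpow_natCast
      ((ρ + |τ|) ^ (-(3 / 2 : ℝ))) 2, ← Real.rpow_mul hτ0.le]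
    norm_num; ring
  have hmb : ∀ τ b, Real.sqrt (∫ x in (ρ + |τ|)..b, F τ x ^ 2) ≤ m τ := fun τ b =>
    (Real.sqrt_le_sqrt ((hslice τ b).trans (le_of_eq (hmsq τ)))).trans
      (le_of_eq (Real.sqrt_sq (hm0 τ)))
  have hmb_fwd : ∀ τ, 0 ≤ τ → ∀ b, ρ + τ ≤ b - τ →
      Real.sqrt (∫ x in (ρ + τ)..(b - τ), F τ x ^ 2) ≤ m τ := by
    intro τ hτ b _
    have := hmb τ (b - τ)
    rwa [abs_of_nonneg hτ] at this
  have hmb_bwd : ∀ τ, τ ≤ 0 → ∀ b, ρ - τ ≤ b + τ →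
      Real.sqrt (∫ x in (ρ - τ)..(b + τ), F τ x ^ 2) ≤ m τ := by
    intro τ hτ b _
    have := hmb τ (b + τ)
    rwa [abs_of_nonpos hτ, ← sub_eq_add_neg] at this
  -- `∫ m ≤ 2|A|√(E₀/2) ρ^{-1/2}` in both directions
  have hIm_fwd : ∀ s, 0 ≤ s → ∫ τ in (0 : ℝ)..s, m τ ≤ |A| * Real.sqrt (E₀ / 2) * (2 * ρ ^ (-(1 / 2 : ℝ))) := by
    intro s hs
    have heq : ∫ τ in (0 : ℝ)..s, m τ
        = |A| * Real.sqrt (E₀ / 2) * ∫ τ in (0 : ℝ)..s, (ρ + τ) ^ (-(3 / 2 : ℝ)) := by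
      rw [← intervalIntegral.integral_const_mul]
      refine intervalIntegral.integral_congr fun τ hτ => ?_
      rw [uIcc_of_le hs] at hτ
      simp only [hm, abs_of_nonneg hτ.1]
    rw [heq]
    exact mul_le_mul_of_nonneg_left (integral_add_rpow_neg_three_halves_le hρ0 hs) (by positivity)
  have hIm_bwd : ∀ s, s ≤ 0 → ∫ τ in s..(0 : ℝ), m τ ≤ |A| * Real.sqrt (E₀ / 2) * (2 * ρ ^ (-(1 / 2 : ℝ))) := by
    intro s hs
    have heq : ∫ τ in s..(0 : ℝ), m τ
        = |A| * Real.sqrt (E₀ / 2) * ∫ τ in (0 : ℝ)..(-s), (ρ + τ) ^ (-(3 / 2 : ℝ)) := by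
      rw [← intervalIntegral.integral_const_mul]
      have h1 : ∫ τ in s..(0 : ℝ), m τ = ∫ τ in (0 : ℝ)..(-s), m (-τ) := by
        rw [intervalIntegral.integral_comp_neg (fun τ => m τ)]; simp
      rw [h1]
      refine intervalIntegral.integral_congr fun τ hτ => ?_
      rw [uIcc_of_le (by linarith)] at hτ
      simp only [hm, abs_neg, abs_of_nonneg hτ.1]
    rw [heq]
    exact mul_le_mul_of_nonneg_left (integral_add_rpow_neg_three_halves_le hρ0 (by linarith))
      (by positivity)
  -- the Duhamel bound for `w` on the far cone, both directions
  have hsq2 : ∀ a b : ℝ, (a + b) ^ 2 ≤ 2 * a ^ 2 + 2 * b ^ 2 := fun a b => by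
    linarith only [sq_nonneg (a - b)]
  have hθ0 : 0 ≤ θ := le_trans (setIntegral_nonneg measurableSet_Ioi fun x _ =>
    wave1D_energyDensity_nonneg (ψ := w) hV0 0 x) hθ.2
  have hkey : ∀ I : ℝ, 0 ≤ I → I ≤ |A| * Real.sqrt (E₀ / 2) * (2 * ρ ^ (-(1 / 2 : ℝ))) →
      (Real.sqrt (∫ x in Ioi ρ, (deriv (fun τ => w τ x) 0 ^ 2 + deriv (w 0) x ^ 2
        + V x * w 0 x ^ 2)) + 2 * I) ^ 2 ≤ 2 * θ + 16 * A ^ 2 * E₀ / ρ := by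
    intro I hI0 hI
    have h1 : Real.sqrt (∫ x in Ioi ρ, (deriv (fun τ => w τ x) 0 ^ 2 + deriv (w 0) x ^ 2
        + V x * w 0 x ^ 2)) ^ 2 ≤ θ := by
      rw [Real.sq_sqrt (setIntegral_nonneg measurableSet_Ioi fun x _ =>
        wave1D_energyDensity_nonneg (ψ := w) hV0 0 x)]
      exact hθ.2
    have h2 : (2 * I) ^ 2 ≤ 8 * A ^ 2 * E₀ / ρ := by
      have h3 : (2 * I) ^ 2 ≤ (2 * (|A| * Real.sqrt (E₀ / 2) * (2 * ρ ^ (-(1 / 2 : ℝ))))) ^ 2 :=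
        pow_le_pow_left₀ (by positivity) (by linarith) 2
      have h4 : (2 * (|A| * Real.sqrt (E₀ / 2) * (2 * ρ ^ (-(1 / 2 : ℝ))))) ^ 2
          = 8 * A ^ 2 * E₀ / ρ := by
        rw [show (2 * (|A| * Real.sqrt (E₀ / 2) * (2 * ρ ^ (-(1 / 2 : ℝ))))) ^ 2
          = 16 * |A| ^ 2 * Real.sqrt (E₀ / 2) ^ 2 * (ρ ^ (-(1 / 2 : ℝ))) ^ 2 by ring,
          sq_abs, Real.sq_sqrt (by positivity), ← Real.rpow_natCast (ρ ^ (-(1 / 2 : ℝ))) 2,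
          ← Real.rpow_mul hρ0.le]
        norm_num
        rw [Real.rpow_neg_one]; field_simp; ring
      linarith
    calc _ ≤ 2 * Real.sqrt (∫ x in Ioi ρ, (deriv (fun τ => w τ x) 0 ^ 2 + deriv (w 0) x ^ 2
          + V x * w 0 x ^ 2)) ^ 2 + 2 * (2 * I) ^ 2 := hsq2 _ _
      _ ≤ 2 * θ + 2 * (8 * A ^ 2 * E₀ / ρ) :=
          add_le_add (mul_le_mul_of_nonneg_left h1 (by norm_num))
            (mul_le_mul_of_nonneg_left h2 (by norm_num))
      _ = 2 * θ + 16 * A ^ 2 * E₀ / ρ := by ring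
  have hwfar : ∫⁻ x in Ioi (ρ + |t|), ENNReal.ofReal (deriv (fun τ => w τ x) t ^ 2
      + deriv (w t) x ^ 2 + V x * w t x ^ 2) ≤ ENNReal.ofReal (2 * θ + 16 * A ^ 2 * E₀ / ρ) := by
    rcases le_total 0 t with ht | ht
    · have h := wave1D_farCone_energy_le_of_data hV hV0 hFc hwC hwsol (a := ρ) hθ.1 hmc hmb_fwd ht
      rw [abs_of_nonneg ht]
      refine h.trans (ENNReal.ofReal_le_ofReal (hkey _ (intervalIntegral.integral_nonneg ht
        fun τ _ => hm0 τ) (hIm_fwd t ht)))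
    · have h := wave1D_farCone_energy_le_of_data_backward hV hV0 hFc hwC hwsol (a := ρ) hθ.1 hmc
        hmb_bwd ht
      rw [abs_of_nonpos ht, ← sub_eq_add_neg]
      refine h.trans (ENNReal.ofReal_le_ofReal (hkey _ (intervalIntegral.integral_nonneg ht
        fun τ _ => hm0 τ) (hIm_bwd t ht)))
  -- pointwise: `e₀[ψ₀] ≤ 4 e_V[φ] + 4 e_V[w]` on `x ≥ ρ`
  have hpt : ∀ x, ρ ≤ x → deriv (fun τ => ψ₀ τ x) t ^ 2 + deriv (ψ₀ t) x ^ 2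
        + n * (n + 1) * ι x ^ 2 * ψ₀ t x ^ 2
      ≤ 4 * (deriv (fun τ => φ τ x) t ^ 2 + deriv (φ t) x ^ 2 + V x * φ t x ^ 2)
        + 4 * (deriv (fun τ => w τ x) t ^ 2 + deriv (w t) x ^ 2 + V x * w t x ^ 2) := by
    intro x hx
    have d1 : DifferentiableAt ℝ (fun τ => φ τ x) t := ((hsl φ hφ t x).1.differentiable (by norm_num)) t
    have d2 : DifferentiableAt ℝ (fun τ => ψ₀ τ x) t :=
      ((hsl ψ₀ hψ₀ t x).1.differentiable (by norm_num)) t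
    have d3 : DifferentiableAt ℝ (φ t) x := ((hsl φ hφ t x).2.differentiable (by norm_num)) x
    have d4 : DifferentiableAt ℝ (ψ₀ t) x := ((hsl ψ₀ hψ₀ t x).2.differentiable (by norm_num)) x
    have e1 : deriv (fun τ => w τ x) t = deriv (fun τ => φ τ x) t - deriv (fun τ => ψ₀ τ x) t :=
      deriv_fun_sub d1 d2
    have e2 : deriv (w t) x = deriv (φ t) x - deriv (ψ₀ t) x := by
      show deriv (fun y => φ t y - ψ₀ t y) x = _
      exact deriv_fun_sub d3 d4
    have e3 : w t x = φ t x - ψ₀ t x := rfl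
    rw [e1, e2, e3]
    have hV2x := hV2 x hx
    have hVx := hV0 x
    have h0 : 0 ≤ ι x ^ 2 * ψ₀ t x ^ 2 := by positivity
    nlinarith [sq_nonneg (deriv (fun τ => φ τ x) t + (deriv (fun τ => φ τ x) t
        - deriv (fun τ => ψ₀ τ x) t)),
      sq_nonneg (deriv (φ t) x + (deriv (φ t) x - deriv (ψ₀ t) x)),
      sq_nonneg (φ t x + (φ t x - ψ₀ t x)), mul_nonneg hVx (sq_nonneg (φ t x + (φ t x - ψ₀ t x))),
      sq_nonneg (deriv (fun τ => φ τ x) t - 2 * deriv (fun τ => ψ₀ τ x) t)]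
  -- integrate
  have hmeasφ : Measurable fun x => ENNReal.ofReal (deriv (fun τ => φ τ x) t ^ 2
      + deriv (φ t) x ^ 2 + V x * φ t x ^ 2) :=
    ENNReal.measurable_ofReal.comp ((continuous_wave1D_energyDensity hV hφ).comp
      (continuous_const.prodMk continuous_id)).measurable
  calc ∫⁻ x in Ioi (ρ + |t|), ENNReal.ofReal (deriv (fun τ => ψ₀ τ x) t ^ 2 + deriv (ψ₀ t) x ^ 2
        + n * (n + 1) * ι x ^ 2 * ψ₀ t x ^ 2)
      ≤ ∫⁻ x in Ioi (ρ + |t|), (4 * ENNReal.ofReal (deriv (fun τ => φ τ x) t ^ 2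
          + deriv (φ t) x ^ 2 + V x * φ t x ^ 2)
        + 4 * ENNReal.ofReal (deriv (fun τ => w τ x) t ^ 2 + deriv (w t) x ^ 2
          + V x * w t x ^ 2)) := by
        refine setLIntegral_mono' measurableSet_Ioi fun x hx => ?_
        have hxρ : ρ ≤ x := by
          have : ρ + |t| < x := hx
          linarith [abs_nonneg t]
        rw [show (4 : ENNReal) = ENNReal.ofReal 4 by norm_num, ← ENNReal.ofReal_mul (by norm_num),
          ← ENNReal.ofReal_mul (by norm_num), ← ENNReal.ofReal_add (by
            have := wave1D_energyDensity_nonneg (ψ := φ) hV0 t x; positivity) (by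
            have := wave1D_energyDensity_nonneg (ψ := w) hV0 t x; positivity)]
        exact ENNReal.ofReal_le_ofReal (hpt x hxρ)
    _ = 4 * (∫⁻ x in Ioi (ρ + |t|), ENNReal.ofReal (deriv (fun τ => φ τ x) t ^ 2
          + deriv (φ t) x ^ 2 + V x * φ t x ^ 2))
        + 4 * (∫⁻ x in Ioi (ρ + |t|), ENNReal.ofReal (deriv (fun τ => w τ x) t ^ 2
          + deriv (w t) x ^ 2 + V x * w t x ^ 2)) := by
        rw [lintegral_add_left (hmeasφ.const_mul _), lintegral_const_mul _ hmeasφ,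
          lintegral_const_mul' _ _ (by norm_num)]
    _ ≤ _ := add_le_add le_rfl (mul_le_mul' le_rfl hwfar)

end Literature.Analysis.PDE
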